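import Mathlib.MeasureTheory.Integral.Bochner.Basic
import Mathlib.MeasureTheory.Integral.Bochner.Set
import Mathlib.MeasureTheory.Function.L1Space.Integrable
import Mathlib.Analysis.SpecialFunctions.Exp
import Mathlib.Topology.Order.Compact
import Mathlib.MeasureTheory.Constructions.BorelSpace.Basic
import HarnessLib

/-!
# Zero-temperature (Laplace) concentration of Gibbs averages at a unique ground state

Folklore («Laplace's principle», zero-temperature limit of a finite-volume Gibbs / DLR-kernel measure):
on a compact space `X` with a finite reference measure `μ`, a continuous energy `H` with a UNIQUE minimiser `x₀`
every neighbourhood of which has positive `μ`-mass, and a continuous observable `f`,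
the Gibbs average `(∫ f e^{-βH} dμ) / (∫ e^{-βH} dμ)` tends to `f x₀` as `β → ∞`.

* `exists_pos_gap_of_unique_min` — outside any open neighbourhood of the unique minimiser the energy exceeds the
  minimum by a positive gap (compactness; the step in Hwang's proof);
* `integral_exp_neg_mul_pos` — the partition function is positive;
* `tendsto_gibbsAverage_unique_min` — the concentration statement.

Used by classical (`β = ∞`, cooling) arguments about lattice gauge / spin kernels with frozen boundary data: the
kernel is a Gibbs measure on the compact group manifold `G^{edges}` with Haar reference measure, so its `β → ∞`
limit is read off the unique minimal-action configuration whenever that minimiser is unique.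
Source: C.-R. Hwang, *Laplace's method revisited: weak convergence of probability measures*, Ann. Probab. 8 (1980)
1177–1182, Theorem 2.1 (the Gibbs measures `e^{-βH}dμ/Z` converge weakly to a measure carried by the minimum set; a
unique minimiser gives `δ_{x₀}`) — here the unique-minimiser case with the test function form of weak convergence;
cf. Dembo–Zeitouni [DemboZeitouni2010] §4.3.  No new definitions.
-/

set_option autoImplicit false

noncomputable section

open MeasureTheory Filter Set
open scoped Topology

namespace Literature.MathematicalPhysics.StatisticalMechanics

variable {X : Type*} [TopologicalSpace X] [CompactSpace X]

/-- On a compact space, a continuous `H` with a unique minimiser `x₀` has a positive energy gap outside every open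
neighbourhood `U` of `x₀`: `∃ δ > 0, ∀ x ∉ U, H x₀ + δ ≤ H x`. [cite: Hwang1980, proof of Thm 2.1] -/
theorem exists_pos_gap_of_unique_min {H : X → ℝ} (hH : Continuous H) {x₀ : X}
    (hmin : ∀ x, x ≠ x₀ → H x₀ < H x) {U : Set X} (hU : IsOpen U) (hx₀ : x₀ ∈ U) :
    ∃ δ : ℝ, 0 < δ ∧ ∀ x, x ∉ U → H x₀ + δ ≤ H x := by
  by_cases hne : (Uᶜ).Nonempty
  · obtain ⟨x₁, hx₁, hmin₁⟩ := hU.isClosed_compl.isCompact.exists_isMinOn hne hH.continuousOn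
    have hx₁₀ : x₁ ≠ x₀ := fun h => hx₁ (h ▸ hx₀)
    refine ⟨H x₁ - H x₀, sub_pos.2 (hmin x₁ hx₁₀), fun x hx => ?_⟩
    have h' : H x₁ ≤ H x := by simpa using hmin₁ (show x ∈ Uᶜ from hx)
    linarith
  · refine ⟨1, one_pos, fun x hx => ?_⟩
    exact absurd ⟨x, hx⟩ hne

variable [MeasurableSpace X] [OpensMeasurableSpace X]

/-- A continuous real function on a compact space is integrable for a finite measure. [folklore] -/
private theorem integrable_of_continuous_compact (μ : Measure X) [IsFiniteMeasure μ] {f : X → ℝ} (hf : Continuous f) :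
    Integrable f μ := by
  obtain ⟨C, hC⟩ := isCompact_univ.exists_bound_of_continuousOn hf.continuousOn
  exact Integrable.mono' (integrable_const C) hf.aestronglyMeasurable
    (ae_of_all _ fun x => hC x (mem_univ x))

/-- The partition function `∫ e^{-β h} dμ` is positive as soon as `μ ≠ 0` (compact `X`, continuous `h`). [cite: Hwang1980, §2] -/
theorem integral_exp_neg_mul_pos (μ : Measure X) [IsFiniteMeasure μ] {h : X → ℝ} (hh : Continuous h) (β : ℝ)
    (hμ : 0 < μ.real univ) : 0 < ∫ x, Real.exp (-β * h x) ∂μ := by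
  obtain ⟨C, hC⟩ := isCompact_univ.exists_bound_of_continuousOn hh.continuousOn
  -- pointwise lower bound by the positive constant `exp (-|β| C)`
  have hlow : ∀ x, Real.exp (-(|β| * C)) ≤ Real.exp (-β * h x) := by
    intro x
    apply Real.exp_le_exp.2
    have h1 : |β * h x| ≤ |β| * C := by
      rw [abs_mul]
      exact mul_le_mul_of_nonneg_left (by simpa using hC x (mem_univ x)) (abs_nonneg _)
    have h2 := le_abs_self (β * h x)
    have h3 : -β * h x = -(β * h x) := by ring
    linarith
  have hint : Integrable (fun x => Real.exp (-β * h x)) μ :=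
    integrable_of_continuous_compact μ (Real.continuous_exp.comp (continuous_const.mul hh))
  calc (0 : ℝ) < Real.exp (-(|β| * C)) * μ.real univ := mul_pos (Real.exp_pos _) hμ
    _ = ∫ _x, Real.exp (-(|β| * C)) ∂μ := by rw [integral_const, smul_eq_mul, mul_comm]
    _ ≤ ∫ x, Real.exp (-β * h x) ∂μ := integral_mono (integrable_const _) hint hlow

/-- **Zero-temperature concentration (Laplace's principle) at a unique ground state.**  `X` compact, `μ` a finite
measure charging every open neighbourhood of `x₀`, `H` continuous with unique minimiser `x₀`, `f` continuous:
`(∫ f·e^{-βH} dμ) / (∫ e^{-βH} dμ) → f x₀` as `β → +∞` (Hwang 1980, Thm 2.1, unique-minimiser case, tested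
against a continuous `f`). [cite: Hwang1980, Thm 2.1] -/
theorem tendsto_gibbsAverage_unique_min (μ : Measure X) [IsFiniteMeasure μ] {H f : X → ℝ}
    (hH : Continuous H) (hf : Continuous f) {x₀ : X} (hmin : ∀ x, x ≠ x₀ → H x₀ < H x)
    (hsupp : ∀ U : Set X, IsOpen U → x₀ ∈ U → 0 < μ.real U) :
    Tendsto (fun β : ℝ => (∫ x, f x * Real.exp (-β * H x) ∂μ) / ∫ x, Real.exp (-β * H x) ∂μ)
      atTop (𝓝 (f x₀)) := by
  -- shifted energy `h = H − H x₀ ≥ 0`, `h x₀ = 0`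
  set h : X → ℝ := fun x => H x - H x₀ with hh_def
  have hh : Continuous h := hH.sub continuous_const
  have hh0 : ∀ x, 0 ≤ h x := by
    intro x
    by_cases hx : x = x₀
    · simp [h, hx]
    · exact sub_nonneg.2 (hmin x hx).le
  have hμ : 0 < μ.real univ := hsupp univ isOpen_univ (mem_univ _)
  obtain ⟨M, hM⟩ := isCompact_univ.exists_bound_of_continuousOn hf.continuousOn
  have hM0 : 0 ≤ M := le_trans (norm_nonneg _) (hM x₀ (mem_univ _))
  have hfb : ∀ x, |f x - f x₀| ≤ 2 * M := by
    intro x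
    have h1 : ‖f x‖ ≤ M := hM x (mem_univ x)
    have h2 : ‖f x₀‖ ≤ M := hM x₀ (mem_univ x₀)
    rw [Real.norm_eq_abs] at h1 h2
    calc |f x - f x₀| ≤ |f x| + |f x₀| := abs_sub _ _
      _ ≤ 2 * M := by linarith
  -- integrability facts
  have hexpH : ∀ β : ℝ, Continuous fun x => Real.exp (-β * H x) := fun β =>
    Real.continuous_exp.comp (continuous_const.mul hH)
  have hexph : ∀ β : ℝ, Continuous fun x => Real.exp (-β * h x) := fun β =>
    Real.continuous_exp.comp (continuous_const.mul hh)
  -- the ratio is unchanged by the shift: e^{-βH x} = e^{-βH x₀} · e^{-β h x}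
  have hfactor : ∀ β x, Real.exp (-β * H x) = Real.exp (-β * H x₀) * Real.exp (-β * h x) := by
    intro β x
    rw [← Real.exp_add]
    congr 1
    simp only [h]
    ring
  have hratio : ∀ β : ℝ, (∫ x, f x * Real.exp (-β * H x) ∂μ) / (∫ x, Real.exp (-β * H x) ∂μ) =
      (∫ x, f x * Real.exp (-β * h x) ∂μ) / (∫ x, Real.exp (-β * h x) ∂μ) := by
    intro β
    have e1 : ∫ x, f x * Real.exp (-β * H x) ∂μ = Real.exp (-β * H x₀) * ∫ x, f x * Real.exp (-β * h x) ∂μ := by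
      rw [← integral_const_mul]
      refine integral_congr_ae (ae_of_all _ fun x => ?_)
      simp only [hfactor β x]
      ring
    have e2 : ∫ x, Real.exp (-β * H x) ∂μ = Real.exp (-β * H x₀) * ∫ x, Real.exp (-β * h x) ∂μ := by
      rw [← integral_const_mul]
      exact integral_congr_ae (ae_of_all _ fun x => hfactor β x)
    rw [e1, e2, mul_div_mul_left _ _ (Real.exp_pos _).ne']
  simp_rw [hratio]
  -- ε-argument
  rw [Metric.tendsto_atTop]
  intro ε hε
  -- neighbourhood where `f` is `ε/2`-close to `f x₀`
  set U : Set X := {x | |f x - f x₀| < ε / 2} with hU_def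
  have hU : IsOpen U := isOpen_lt (continuous_abs.comp (hf.sub continuous_const)) continuous_const
  have hx₀U : x₀ ∈ U := by simp [U, hε]
  -- energy gap `δ` off `U`, for the shifted energy `h` (unique minimiser `x₀` as well)
  have hmin' : ∀ x, x ≠ x₀ → h x₀ < h x := fun x hx => by
    simp only [h, sub_self]; exact sub_pos.2 (hmin x hx)
  obtain ⟨δ, hδ, hgap⟩ := exists_pos_gap_of_unique_min hh hmin' hU hx₀U
  have hgap' : ∀ x, x ∉ U → δ ≤ h x := fun x hx => by have := hgap x hx; simp only [h, sub_self] at this ⊢; linarith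
  -- the well `V = {h < δ/2}` has positive mass `m`
  set V : Set X := {x | h x < δ / 2} with hV_def
  have hV : IsOpen V := isOpen_lt hh continuous_const
  have hVmeas : MeasurableSet V := hV.measurableSet
  have hx₀V : x₀ ∈ V := by simp [V, h, hδ]
  set m : ℝ := μ.real V with hm_def
  have hm : 0 < m := hsupp V hV hx₀V
  -- choose β₀ with (2 M μ(univ) / m) e^{-β δ/2} < ε/2 for β ≥ β₀, and β₀ ≥ 0
  set A : ℝ := 2 * M * μ.real univ / m with hA_def
  have hA0 : 0 ≤ A := by positivity
  have hlim : Tendsto (fun β : ℝ => A * Real.exp (-(β * (δ / 2)))) atTop (𝓝 0) := by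
    have : Tendsto (fun β : ℝ => Real.exp (-(β * (δ / 2)))) atTop (𝓝 0) := by
      refine Real.tendsto_exp_atBot.comp ?_
      refine tendsto_neg_atTop_atBot.comp ?_
      exact tendsto_id.atTop_mul_const (by positivity)
    simpa using this.const_mul A
  obtain ⟨β₁, hβ₁⟩ := (Metric.tendsto_atTop.1 hlim) (ε / 2) (by positivity)
  refine ⟨max β₁ 0, fun β hβ => ?_⟩
  have hβ0 : 0 ≤ β := le_trans (le_max_right _ _) hβ
  have hβ1 : β₁ ≤ β := le_trans (le_max_left _ _) hβ
  have hsmall : A * Real.exp (-(β * (δ / 2))) < ε / 2 := by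
    have := hβ₁ β hβ1
    rw [Real.dist_eq, sub_zero, abs_of_nonneg (by positivity)] at this
    exact this
  -- partition function and its lower bound `Z ≥ m e^{-β δ/2}`
  set Z : ℝ := ∫ x, Real.exp (-β * h x) ∂μ with hZ_def
  have hZint : Integrable (fun x => Real.exp (-β * h x)) μ := integrable_of_continuous_compact μ (hexph β)
  have hZpos : 0 < Z := integral_exp_neg_mul_pos μ hh β hμ
  have hZlow : m * Real.exp (-(β * (δ / 2))) ≤ Z := by
    have hpt : ∀ x, V.indicator (fun _ => Real.exp (-(β * (δ / 2)))) x ≤ Real.exp (-β * h x) := by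
      intro x
      by_cases hx : x ∈ V
      · rw [indicator_of_mem hx]
        apply Real.exp_le_exp.2
        have : h x < δ / 2 := hx
        nlinarith
      · rw [indicator_of_notMem hx]; exact (Real.exp_pos _).le
    calc m * Real.exp (-(β * (δ / 2))) = ∫ x, V.indicator (fun _ => Real.exp (-(β * (δ / 2)))) x ∂μ := by
          rw [integral_indicator_const _ hVmeas, smul_eq_mul, hm_def]
      _ ≤ Z := integral_mono ((integrable_const _).indicator hVmeas) hZint hpt
  -- numerator: `∫ f e^{-βh} − f x₀ Z = ∫ (f − f x₀) e^{-βh}` and its bound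
  have hfint : Integrable (fun x => f x * Real.exp (-β * h x)) μ :=
    integrable_of_continuous_compact μ (hf.mul (hexph β))
  have hgint : Integrable (fun x => (f x - f x₀) * Real.exp (-β * h x)) μ :=
    integrable_of_continuous_compact μ ((hf.sub continuous_const).mul (hexph β))
  have hnum : (∫ x, f x * Real.exp (-β * h x) ∂μ) - f x₀ * Z = ∫ x, (f x - f x₀) * Real.exp (-β * h x) ∂μ := by
    rw [hZ_def, ← integral_const_mul, ← integral_sub hfint (hZint.const_mul _)]
    refine integral_congr_ae (ae_of_all _ fun x => ?_)
    ring
  have hbound : |∫ x, (f x - f x₀) * Real.exp (-β * h x) ∂μ| ≤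
      (ε / 2) * Z + 2 * M * Real.exp (-(β * δ)) * μ.real univ := by
    have hpt : ∀ x, |(f x - f x₀) * Real.exp (-β * h x)| ≤
        (ε / 2) * Real.exp (-β * h x) + 2 * M * Real.exp (-(β * δ)) := by
      intro x
      rw [abs_mul, abs_of_pos (Real.exp_pos _)]
      by_cases hx : x ∈ U
      · have h1 : |f x - f x₀| < ε / 2 := hx
        have h2 : 0 ≤ 2 * M * Real.exp (-(β * δ)) := by positivity
        nlinarith [Real.exp_pos (-β * h x)]
      · have h1 : |f x - f x₀| ≤ 2 * M := hfb x
        have h2 : Real.exp (-β * h x) ≤ Real.exp (-(β * δ)) := by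
          apply Real.exp_le_exp.2
          have := hgap' x hx
          nlinarith
        have h3 : 0 ≤ (ε / 2) * Real.exp (-β * h x) := by positivity
        calc |f x - f x₀| * Real.exp (-β * h x) ≤ 2 * M * Real.exp (-(β * δ)) :=
              mul_le_mul h1 h2 (Real.exp_pos _).le (by positivity)
          _ ≤ (ε / 2) * Real.exp (-β * h x) + 2 * M * Real.exp (-(β * δ)) := by linarith
    calc |∫ x, (f x - f x₀) * Real.exp (-β * h x) ∂μ|
        ≤ ∫ x, |(f x - f x₀) * Real.exp (-β * h x)| ∂μ := by
          simpa only [Real.norm_eq_abs] using norm_integral_le_integral_norm (μ := μ)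
            (fun x => (f x - f x₀) * Real.exp (-β * h x))
      _ ≤ ∫ x, ((ε / 2) * Real.exp (-β * h x) + 2 * M * Real.exp (-(β * δ))) ∂μ :=
          integral_mono hgint.abs ((hZint.const_mul _).add (integrable_const _)) hpt
      _ = (ε / 2) * Z + 2 * M * Real.exp (-(β * δ)) * μ.real univ := by
          rw [integral_add (hZint.const_mul _) (integrable_const _), integral_const_mul, integral_const,
            smul_eq_mul, hZ_def]
          ring
  -- conclude
  rw [Real.dist_eq]
  have hkey : (∫ x, f x * Real.exp (-β * h x) ∂μ) / Z - f x₀ =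
      (∫ x, (f x - f x₀) * Real.exp (-β * h x) ∂μ) / Z := by
    rw [← hnum, sub_div, mul_div_assoc, div_self hZpos.ne', mul_one]
  rw [hkey, abs_div, abs_of_pos hZpos, div_lt_iff₀ hZpos]
  have hexp2 : Real.exp (-(β * δ)) = Real.exp (-(β * (δ / 2))) * Real.exp (-(β * (δ / 2))) := by
    rw [← Real.exp_add]; congr 1; ring
  -- 2 M e^{-βδ} μ(univ) = A e^{-βδ/2} · (m e^{-βδ/2}) ≤ A e^{-βδ/2} · Z < (ε/2) Z
  have hsecond : 2 * M * Real.exp (-(β * δ)) * μ.real univ ≤ A * Real.exp (-(β * (δ / 2))) * Z := by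
    have e : 2 * M * Real.exp (-(β * δ)) * μ.real univ =
        A * Real.exp (-(β * (δ / 2))) * (m * Real.exp (-(β * (δ / 2)))) := by
      rw [hexp2, hA_def]
      field_simp
    rw [e]
    exact mul_le_mul_of_nonneg_left hZlow (by positivity)
  calc |∫ x, (f x - f x₀) * Real.exp (-β * h x) ∂μ|
      ≤ (ε / 2) * Z + 2 * M * Real.exp (-(β * δ)) * μ.real univ := hbound
    _ ≤ (ε / 2) * Z + A * Real.exp (-(β * (δ / 2))) * Z := by linarith
    _ < (ε / 2) * Z + (ε / 2) * Z := by
        have := mul_lt_mul_of_pos_right hsmall hZpos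
        linarith
    _ = ε * Z := by ring


/-! ## Degenerate ground states (Hwang 1980, Thm 2.1 in full): the Gibbs mass leaves every neighbourhood of the
minimum set, so Gibbs averages of a continuous `f` are eventually squeezed between `inf f` and `sup f` over the minimum set -/

omit [MeasurableSpace X] [OpensMeasurableSpace X] in
/-- Outside any open set `U` containing the whole minimum set `{H = m}` (with `m` the minimum value, attained at `x₀`), a continuous
`H` on a compact space exceeds `m` by a positive gap. [cite: Hwang1980, proof of Thm 2.1] -/
theorem exists_pos_gap_of_argmin_subset {H : X → ℝ} (hH : Continuous H) {x₀ : X} (hx₀ : ∀ x, H x₀ ≤ H x)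
    {U : Set X} (hU : IsOpen U) (hMU : ∀ x, H x = H x₀ → x ∈ U) :
    ∃ δ : ℝ, 0 < δ ∧ ∀ x, x ∉ U → H x₀ + δ ≤ H x := by
  by_cases hne : (Uᶜ).Nonempty
  · obtain ⟨x₁, hx₁, hmin₁⟩ := hU.isClosed_compl.isCompact.exists_isMinOn hne hH.continuousOn
    have hne₁ : H x₁ ≠ H x₀ := fun h => hx₁ (hMU x₁ h)
    have hlt : H x₀ < H x₁ := lt_of_le_of_ne (hx₀ x₁) (Ne.symm hne₁)
    refine ⟨H x₁ - H x₀, sub_pos.2 hlt, fun x hx => ?_⟩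
    have h' : H x₁ ≤ H x := by simpa using hmin₁ (show x ∈ Uᶜ from hx)
    linarith
  · exact ⟨1, one_pos, fun x hx => absurd ⟨x, hx⟩ hne⟩

/-- **Gibbs mass of the complement of a neighbourhood of the minimum set is exponentially small** (compact `X`, finite `μ`
charging every open set that contains the minimiser `x₀`): for `U` open containing `{H = min H}` there are `δ > 0`, `A ≥ 0`
with `(∫_{Uᶜ} e^{-βH}) ≤ A e^{-βδ/2} (∫ e^{-βH})` for all `β ≥ 0`, written multiplicatively. [cite: Hwang1980, Thm 2.1] -/
theorem gibbsMass_compl_le (μ : Measure X) [IsFiniteMeasure μ] {H : X → ℝ} (hH : Continuous H) {x₀ : X}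
    (hx₀ : ∀ x, H x₀ ≤ H x) (hsupp : ∀ V : Set X, IsOpen V → x₀ ∈ V → 0 < μ.real V)
    {U : Set X} (hU : IsOpen U) (hMU : ∀ x, H x = H x₀ → x ∈ U) :
    ∃ δ A : ℝ, 0 < δ ∧ 0 ≤ A ∧ ∀ β : ℝ, 0 ≤ β →
      ∫ x, Uᶜ.indicator (fun x => Real.exp (-β * (H x - H x₀))) x ∂μ ≤
        A * Real.exp (-(β * (δ / 2))) * ∫ x, Real.exp (-β * (H x - H x₀)) ∂μ := by
  obtain ⟨δ, hδ, hgap⟩ := exists_pos_gap_of_argmin_subset hH hx₀ hU hMU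
  set h : X → ℝ := fun x => H x - H x₀ with hh_def
  have hh : Continuous h := hH.sub continuous_const
  set V : Set X := {x | h x < δ / 2} with hV_def
  have hV : IsOpen V := isOpen_lt hh continuous_const
  have hx₀V : x₀ ∈ V := by simp [V, h, hδ]
  set m : ℝ := μ.real V
  have hm : 0 < m := hsupp V hV hx₀V
  refine ⟨δ, μ.real univ / m, hδ, by positivity, fun β hβ => ?_⟩
  have hZint : Integrable (fun x => Real.exp (-β * h x)) μ :=
    integrable_of_continuous_compact μ (Real.continuous_exp.comp (continuous_const.mul hh))
  -- lower bound on Z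
  have hZlow : m * Real.exp (-(β * (δ / 2))) ≤ ∫ x, Real.exp (-β * h x) ∂μ := by
    have hpt : ∀ x, V.indicator (fun _ => Real.exp (-(β * (δ / 2)))) x ≤ Real.exp (-β * h x) := by
      intro x
      by_cases hx : x ∈ V
      · rw [indicator_of_mem hx]
        apply Real.exp_le_exp.2
        have : h x < δ / 2 := hx
        nlinarith
      · rw [indicator_of_notMem hx]; exact (Real.exp_pos _).le
    calc m * Real.exp (-(β * (δ / 2))) = ∫ x, V.indicator (fun _ => Real.exp (-(β * (δ / 2)))) x ∂μ := by
          rw [integral_indicator_const _ hV.measurableSet, smul_eq_mul]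
      _ ≤ _ := integral_mono ((integrable_const _).indicator hV.measurableSet) hZint hpt
  -- upper bound on the mass outside U
  have hUc : MeasurableSet Uᶜ := hU.measurableSet.compl
  have hout : ∫ x, Uᶜ.indicator (fun x => Real.exp (-β * h x)) x ∂μ ≤ μ.real univ * Real.exp (-(β * δ)) := by
    have hpt : ∀ x, Uᶜ.indicator (fun x => Real.exp (-β * h x)) x ≤ Real.exp (-(β * δ)) := by
      intro x
      by_cases hx : x ∈ Uᶜ
      · rw [indicator_of_mem hx]
        apply Real.exp_le_exp.2
        have := hgap x hx
        have : δ ≤ h x := by simp only [h]; linarith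
        nlinarith
      · rw [indicator_of_notMem hx]; exact (Real.exp_pos _).le
    calc ∫ x, Uᶜ.indicator (fun x => Real.exp (-β * h x)) x ∂μ ≤ ∫ _x, Real.exp (-(β * δ)) ∂μ :=
          integral_mono (hZint.indicator hUc) (integrable_const _) hpt
      _ = μ.real univ * Real.exp (-(β * δ)) := by rw [integral_const, smul_eq_mul]
  have hexp2 : Real.exp (-(β * δ)) = Real.exp (-(β * (δ / 2))) * Real.exp (-(β * (δ / 2))) := by
    rw [← Real.exp_add]; congr 1; ring
  calc ∫ x, Uᶜ.indicator (fun x => Real.exp (-β * h x)) x ∂μ ≤ μ.real univ * Real.exp (-(β * δ)) := hout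
    _ = μ.real univ / m * Real.exp (-(β * (δ / 2))) * (m * Real.exp (-(β * (δ / 2)))) := by
        rw [hexp2]; field_simp
    _ ≤ μ.real univ / m * Real.exp (-(β * (δ / 2))) * ∫ x, Real.exp (-β * h x) ∂μ :=
        mul_le_mul_of_nonneg_left hZlow (by positivity)

/-- **Hwang's Theorem 2.1, upper half, degenerate case.**  If a continuous `f` is `≤ c` on the minimum set `{H = min H}`, then for
every `ε > 0` the Gibbs averages of `f` are eventually `≤ c + ε` as `β → ∞`. [cite: Hwang1980, Thm 2.1] -/
theorem gibbsAverage_eventually_le (μ : Measure X) [IsFiniteMeasure μ] {H f : X → ℝ}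
    (hH : Continuous H) (hf : Continuous f) {x₀ : X} (hx₀ : ∀ x, H x₀ ≤ H x)
    (hsupp : ∀ V : Set X, IsOpen V → x₀ ∈ V → 0 < μ.real V) {c : ℝ} (hc : ∀ x, H x = H x₀ → f x ≤ c)
    {ε : ℝ} (hε : 0 < ε) :
    ∀ᶠ β : ℝ in atTop, (∫ x, f x * Real.exp (-β * H x) ∂μ) / (∫ x, Real.exp (-β * H x) ∂μ) ≤ c + ε := by
  -- shifted energy and the shift-invariance of the ratio (as in `tendsto_gibbsAverage_unique_min`)
  set h : X → ℝ := fun x => H x - H x₀ with hh_def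
  have hh : Continuous h := hH.sub continuous_const
  have hμ : 0 < μ.real univ := hsupp univ isOpen_univ (mem_univ _)
  obtain ⟨M, hM⟩ := isCompact_univ.exists_bound_of_continuousOn hf.continuousOn
  have hexph : ∀ β : ℝ, Continuous fun x => Real.exp (-β * h x) := fun β =>
    Real.continuous_exp.comp (continuous_const.mul hh)
  have hfactor : ∀ β x, Real.exp (-β * H x) = Real.exp (-β * H x₀) * Real.exp (-β * h x) := by
    intro β x; rw [← Real.exp_add]; congr 1; simp only [h]; ring
  have hratio : ∀ β : ℝ, (∫ x, f x * Real.exp (-β * H x) ∂μ) / (∫ x, Real.exp (-β * H x) ∂μ) =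
      (∫ x, f x * Real.exp (-β * h x) ∂μ) / (∫ x, Real.exp (-β * h x) ∂μ) := by
    intro β
    have e1 : ∫ x, f x * Real.exp (-β * H x) ∂μ = Real.exp (-β * H x₀) * ∫ x, f x * Real.exp (-β * h x) ∂μ := by
      rw [← integral_const_mul]
      refine integral_congr_ae (ae_of_all _ fun x => ?_)
      simp only [hfactor β x]; ring
    have e2 : ∫ x, Real.exp (-β * H x) ∂μ = Real.exp (-β * H x₀) * ∫ x, Real.exp (-β * h x) ∂μ := by
      rw [← integral_const_mul]
      exact integral_congr_ae (ae_of_all _ fun x => hfactor β x)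
    rw [e1, e2, mul_div_mul_left _ _ (Real.exp_pos _).ne']
  -- neighbourhood of the minimum set where f ≤ c + ε/2
  set U : Set X := {x | f x < c + ε / 2} with hU_def
  have hU : IsOpen U := isOpen_lt hf continuous_const
  have hMU : ∀ x, H x = H x₀ → x ∈ U := fun x hx => by
    have := hc x hx; simp only [U, mem_setOf_eq]; linarith
  obtain ⟨δ, A, hδ, hA, hmass⟩ := gibbsMass_compl_le μ hH hx₀ hsupp hU hMU
  -- choose β large: A e^{-βδ/2} (|c| + M + 1) < ε/2
  have hlim : Tendsto (fun β : ℝ => A * Real.exp (-(β * (δ / 2)))) atTop (𝓝 0) := by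
    have : Tendsto (fun β : ℝ => Real.exp (-(β * (δ / 2)))) atTop (𝓝 0) :=
      Real.tendsto_exp_atBot.comp (tendsto_neg_atTop_atBot.comp (tendsto_id.atTop_mul_const (by positivity)))
    simpa using this.const_mul A
  have hM0 : 0 ≤ M := le_trans (norm_nonneg _) (hM x₀ (mem_univ _))
  set L : ℝ := |c| + M + 1 with hL
  have hL0 : 0 < L := by positivity
  obtain ⟨β₁, hβ₁⟩ := (Metric.tendsto_atTop.1 hlim) (ε / 2 / L) (by positivity)
  refine eventually_atTop.2 ⟨max β₁ 0, fun β hβ => ?_⟩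
  have hβ0 : 0 ≤ β := le_trans (le_max_right _ _) hβ
  have hsmall : A * Real.exp (-(β * (δ / 2))) < ε / 2 / L := by
    have := hβ₁ β (le_trans (le_max_left _ _) hβ)
    rw [Real.dist_eq, sub_zero, abs_of_nonneg (by positivity)] at this
    exact this
  rw [hratio β]
  set Z : ℝ := ∫ x, Real.exp (-β * h x) ∂μ with hZ_def
  have hZint : Integrable (fun x => Real.exp (-β * h x)) μ := integrable_of_continuous_compact μ (hexph β)
  have hZpos : 0 < Z := integral_exp_neg_mul_pos μ hh β hμ
  have hfint : Integrable (fun x => f x * Real.exp (-β * h x)) μ :=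
    integrable_of_continuous_compact μ (hf.mul (hexph β))
  -- pointwise: f e^{-βh} ≤ (c + ε/2) e^{-βh} + L · 1_{Uᶜ} e^{-βh}   (on U: first term; off U: f ≤ M ≤ L - |c| … )
  have hUc : MeasurableSet Uᶜ := hU.measurableSet.compl
  have hpt : ∀ x, f x * Real.exp (-β * h x) ≤
      (c + ε / 2) * Real.exp (-β * h x) + L * Uᶜ.indicator (fun x => Real.exp (-β * h x)) x := by
    intro x
    have hex : 0 < Real.exp (-β * h x) := Real.exp_pos _
    by_cases hx : x ∈ U
    · have h1 : f x < c + ε / 2 := hx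
      have h2 : Uᶜ.indicator (fun x => Real.exp (-β * h x)) x = 0 := indicator_of_notMem (fun h' => ((Set.mem_compl_iff _ _).1 h') hx) _
      rw [h2, mul_zero, add_zero]
      exact mul_le_mul_of_nonneg_right h1.le hex.le
    · have h2 : Uᶜ.indicator (fun x => Real.exp (-β * h x)) x = Real.exp (-β * h x) := indicator_of_mem hx _
      rw [h2]
      have hfx : f x ≤ M := by
        have := hM x (mem_univ x); rw [Real.norm_eq_abs] at this; exact le_trans (le_abs_self _) this
      have hcL : f x ≤ (c + ε / 2) + L := by
        have : -|c| ≤ c := neg_abs_le c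
        simp only [hL]; linarith
      nlinarith
  have hrhs_int : Integrable (fun x => (c + ε / 2) * Real.exp (-β * h x) +
      L * Uᶜ.indicator (fun x => Real.exp (-β * h x)) x) μ :=
    (hZint.const_mul _).add ((hZint.indicator hUc).const_mul _)
  have hint_le : ∫ x, f x * Real.exp (-β * h x) ∂μ ≤
      (c + ε / 2) * Z + L * ∫ x, Uᶜ.indicator (fun x => Real.exp (-β * h x)) x ∂μ := by
    calc ∫ x, f x * Real.exp (-β * h x) ∂μ
        ≤ ∫ x, ((c + ε / 2) * Real.exp (-β * h x) + L * Uᶜ.indicator (fun x => Real.exp (-β * h x)) x) ∂μ :=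
          integral_mono hfint hrhs_int hpt
      _ = (c + ε / 2) * Z + L * ∫ x, Uᶜ.indicator (fun x => Real.exp (-β * h x)) x ∂μ := by
          rw [integral_add (hZint.const_mul _) ((hZint.indicator hUc).const_mul _), integral_const_mul,
            integral_const_mul]
  have hmassβ := hmass β hβ0
  -- combine: ∫ f e ≤ (c + ε/2) Z + L A e^{-βδ/2} Z < (c + ε/2) Z + (ε/2) Z
  have hsecond : L * ∫ x, Uᶜ.indicator (fun x => Real.exp (-β * h x)) x ∂μ ≤ L * (A * Real.exp (-(β * (δ / 2))) * Z) :=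
    mul_le_mul_of_nonneg_left hmassβ hL0.le
  have hthird : L * (A * Real.exp (-(β * (δ / 2))) * Z) < (ε / 2) * Z := by
    have h1 : L * (A * Real.exp (-(β * (δ / 2)))) < L * (ε / 2 / L) := mul_lt_mul_of_pos_left hsmall hL0
    have h2 : L * (ε / 2 / L) = ε / 2 := by field_simp
    have := mul_lt_mul_of_pos_right (h2 ▸ h1) hZpos
    linarith [this]
  rw [div_le_iff₀ hZpos]
  linarith

/-- **Hwang's Theorem 2.1, lower half, degenerate case**: if `c ≤ f` on the minimum set, the Gibbs averages are eventually `≥ c − ε`.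
[cite: Hwang1980, Thm 2.1] -/
theorem gibbsAverage_eventually_ge (μ : Measure X) [IsFiniteMeasure μ] {H f : X → ℝ}
    (hH : Continuous H) (hf : Continuous f) {x₀ : X} (hx₀ : ∀ x, H x₀ ≤ H x)
    (hsupp : ∀ V : Set X, IsOpen V → x₀ ∈ V → 0 < μ.real V) {c : ℝ} (hc : ∀ x, H x = H x₀ → c ≤ f x)
    {ε : ℝ} (hε : 0 < ε) :
    ∀ᶠ β : ℝ in atTop, c - ε ≤ (∫ x, f x * Real.exp (-β * H x) ∂μ) / (∫ x, Real.exp (-β * H x) ∂μ) := by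
  have hneg := gibbsAverage_eventually_le μ hH hf.neg hx₀ hsupp (c := -c)
    (fun x hx => by simpa using neg_le_neg (hc x hx)) hε
  refine hneg.mono fun β hβ => ?_
  have e : (∫ x, (-f) x * Real.exp (-β * H x) ∂μ) = -∫ x, f x * Real.exp (-β * H x) ∂μ := by
    rw [← integral_neg]; refine integral_congr_ae (ae_of_all _ fun x => ?_); simp [neg_mul]
  rw [e, neg_div] at hβ
  linarith

end Literature.MathematicalPhysics.StatisticalMechanics

end
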